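import Summits.CriticalPhenomena.PercolationContinuityZ3.Theorems.SahiMasterFamilyPhiVertexDisjoint
import Summits.CriticalPhenomena.PercolationContinuityZ3.Theorems.SahiMasterFamilyPhiProduct

/-!
# `Φ_n` is AFFINE along every direction supported on a pairwise-intersecting family of sets;
# `(UC-hull)_n` on all "intersecting-variation" mixtures, every order

Unit `prim-masterthm-p4` (gen 21; crux anchor stmt-CriticalPhenomena-4575, helper work; memo
`run/shared/lean/prim/prim-masterthm/prim-masterthm-p4/P4-GEN21-REPORT.md` §2).  Companion of `…PhiVertex` / `…PhiVertexDisjoint` ((V): `Φ ≥ 0` at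
every union-closed vertex; `disjoint_block`) and `…GHConjecture` (`UCHullNonneg k`, the union-closed-hull conjecture).

Sahi's set-partition functional `Φ_n(β) = Σ_{π ⊢ [n]} (−1)^{|π|−1} ∏_{B∈π} (|B|−1)!·β_B` (`PrincipalCapBeta.phiSet`) is a polynomial
which is affine in each single coordinate `β_S` (the blocks of a set partition are distinct).  MORE IS TRUE: the blocks of a set
partition are pairwise DISJOINT, so no monomial of `Φ_n` contains two coordinates `β_S, β_T` with `S ∩ T ≠ ∅`.  Hence
(`phiSet_add_of_inter`) for every perturbation `u` supported on a PAIRWISE-INTERSECTING family (`Disjoint S T → u S · u T = 0`)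
`Φ_n(β + u) = Φ_n(β) + (explicit expression linear in u)`, i.e. **`Φ_n` is affine along `u`** (`phiSet_add_smul_of_inter`,
`phiSet_lineMap_of_inter`).  Consequences, for EVERY `n`:
* `phiSet_mixture_eq_sum_of_inter`: a finite mixture `Σ_x w_x β^x` (`Σ w_x = 1`) of set functions all of whose VARYING coordinates
  (`β^x_S ≠ β^y_S`) form a pairwise-intersecting family has `Φ_n(Σ_x w_x β^x) = Σ_x w_x Φ_n(β^x)`;
* **`ucHull_of_inter`**: `(UC-hull)_n` holds on every such mixture of union-closed families `𝒰_x ∋ univ` — the families may differ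
  arbitrarily inside any pairwise-intersecting family of sets (e.g. inside `{S : a ∈ S}`), a genuinely mixed (non-chain, in general
  not min-closed) infinite stratum of the union-closed polytope, every order; `ucHull_pair_of_inter` is the two-family case
  (`𝒰 Δ 𝒱` pairwise intersecting: `Φ` is affine on the edge `[1_𝒰, 1_𝒱]`).
Memo §2 uses the affine structure for a FACE-DESCENT reduction of `(UC-hull)_k` (the minimum of `Φ` over the polytope is attained on
faces whose linear span contains no intersecting direction) and a certified-move census (k = 4: all but three orbit-pairs of
union-closed families reduce to chains).  HONEST FRAMING: structural; `UCHullNonneg k` (k ≥ 8), Sahi's `C_k`, Kahn's Conjecture 5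
and the master theorem remain OPEN.  Axioms standard. [this work]
-/

noncomputable section

open scoped Classical

namespace Summit.CriticalPhenomena.PercolationContinuityZ3.Theorems

namespace PhiAffine

open Finset Function
open Literature.Combinatorics.Sahi2008
open PrincipalCapBeta (phiSet)

variable {n : ℕ}

/-! ### Products with pairwise-annihilating perturbations -/

/-- If the perturbations annihilate pairwise (`b i · b j = 0` for `i ≠ j`) then a product of sums keeps only the terms with at
most one perturbed factor: `∏ (a + b) = ∏ a + Σ_i b_i ∏_{j ≠ i} a_j`. [this work] -/
theorem prod_add_eq_of_mul_eq_zero {ι : Type*} [Fintype ι] [DecidableEq ι] (a b : ι → ℝ)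
    (hb : ∀ i j, i ≠ j → b i * b j = 0) :
    ∏ i, (a i + b i) = ∏ i, a i + ∑ i, b i * ∏ j ∈ univ.erase i, a j := by
  have key : ∀ s : Finset ι, ∏ i ∈ s, (a i + b i) = ∏ i ∈ s, a i + ∑ i ∈ s, b i * ∏ j ∈ s.erase i, a j := by
    intro s
    induction s using Finset.induction_on with
    | empty => simp
    | insert x s hx ih =>
      rw [prod_insert hx, prod_insert hx, sum_insert hx, ih, erase_insert hx]
      have e1 : ∑ i ∈ s, b i * ∏ j ∈ (insert x s).erase i, a j = a x * ∑ i ∈ s, b i * ∏ j ∈ s.erase i, a j := by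
        rw [mul_sum]
        refine sum_congr rfl fun i hi => ?_
        have hix : i ≠ x := fun h => hx (h ▸ hi)
        rw [erase_insert_of_ne hix.symm, prod_insert (fun h => hx (mem_of_mem_erase h))]
        ring
      have e2 : b x * ∑ i ∈ s, b i * ∏ j ∈ s.erase i, a j = 0 := by
        rw [mul_sum]
        refine sum_eq_zero fun i hi => ?_
        have hix : x ≠ i := fun h => hx (h ▸ hi)
        rw [← mul_assoc, hb x i hix, zero_mul]
      rw [e1]
      linear_combination e2
  simpa using key univ

/-! ### The affine expansion -/

/-- **`Φ_n` is affine along intersecting directions.**  If `u` is supported on a pairwise-intersecting family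
(`Disjoint S T → u S · u T = 0`) then
`Φ_n(β + u) = Φ_n(β) + Σ_π (−1)^{|π|−1} Σ_{j} (|π_j|−1)!·u(π_j) · ∏_{i ≠ j} (|π_i|−1)!·β(π_i)` — an expression LINEAR in `u`.
[this work] -/
theorem phiSet_add_of_inter (β u : Finset (Fin n) → ℝ) (hu : ∀ S T, Disjoint S T → u S * u T = 0) :
    phiSet n (fun S => β S + u S) = phiSet n β +
      ∑ c : OrderedFinpartition n, (-1 : ℝ) ^ (c.length - 1) *
        ∑ j : Fin c.length, (((c.partSize j - 1).factorial : ℝ) * u (PartitionForm.block c j)) *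
          ∏ i ∈ univ.erase j, (((c.partSize i - 1).factorial : ℝ) * β (PartitionForm.block c i)) := by
  unfold PrincipalCapBeta.phiSet
  rw [← sum_add_distrib]
  refine sum_congr rfl fun c _ => ?_
  rw [← mul_add]
  congr 1
  have e := prod_add_eq_of_mul_eq_zero
    (fun j : Fin c.length => ((c.partSize j - 1).factorial : ℝ) * β (PartitionForm.block c j))
    (fun j : Fin c.length => ((c.partSize j - 1).factorial : ℝ) * u (PartitionForm.block c j))
    (fun i j hij => by
      have h0 := hu _ _ (PhiVertexDisjoint.disjoint_block c hij)
      calc ((c.partSize i - 1).factorial : ℝ) * u (PartitionForm.block c i) *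
            (((c.partSize j - 1).factorial : ℝ) * u (PartitionForm.block c j))
          = ((c.partSize i - 1).factorial : ℝ) * ((c.partSize j - 1).factorial : ℝ) *
            (u (PartitionForm.block c i) * u (PartitionForm.block c j)) := by ring
        _ = 0 := by rw [h0, mul_zero])
  simp only at e
  rw [← e]
  refine prod_congr rfl fun j _ => ?_
  ring

/-- **Affine along the line**: `Φ_n(β + s·u) = Φ_n(β) + s·(Φ_n(β + u) − Φ_n(β))` for every real `s`, whenever `u` is supported on a
pairwise-intersecting family. [this work] -/
theorem phiSet_add_smul_of_inter (β u : Finset (Fin n) → ℝ) (hu : ∀ S T, Disjoint S T → u S * u T = 0) (s : ℝ) :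
    phiSet n (fun S => β S + s * u S) =
      phiSet n β + s * (phiSet n (fun S => β S + u S) - phiSet n β) := by
  have hsu : ∀ S T, Disjoint S T → (s * u S) * (s * u T) = 0 := fun S T hST => by
    calc (s * u S) * (s * u T) = s * s * (u S * u T) := by ring
      _ = 0 := by rw [hu S T hST, mul_zero]
  rw [phiSet_add_of_inter β (fun S => s * u S) hsu, phiSet_add_of_inter β u hu, add_sub_cancel_left, mul_sum]
  congr 1
  refine sum_congr rfl fun c _ => ?_
  rw [mul_sum, mul_sum, mul_sum]
  refine sum_congr rfl fun j _ => ?_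
  ring

/-- **Affine on segments**: if `β¹ − β⁰` is supported on a pairwise-intersecting family then
`Φ_n((1−s)β⁰ + sβ¹) = (1−s)Φ_n(β⁰) + sΦ_n(β¹)` for every real `s`. [this work] -/
theorem phiSet_lineMap_of_inter (β₀ β₁ : Finset (Fin n) → ℝ)
    (h : ∀ S T, Disjoint S T → (β₁ S - β₀ S) * (β₁ T - β₀ T) = 0) (s : ℝ) :
    phiSet n (fun S => (1 - s) * β₀ S + s * β₁ S) = (1 - s) * phiSet n β₀ + s * phiSet n β₁ := by
  have e1 : (fun S => (1 - s) * β₀ S + s * β₁ S) = fun S => β₀ S + s * (β₁ S - β₀ S) := by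
    funext S; ring
  have e2 : (fun S => β₀ S + (β₁ S - β₀ S)) = β₁ := by funext S; ring
  rw [e1, phiSet_add_smul_of_inter β₀ (fun S => β₁ S - β₀ S) h s, e2]
  ring

/-! ### Mixtures whose varying coordinates form an intersecting family -/

/-- **Mixtures with intersecting variation.**  Let `β^x` (`x ∈ α`, finite) be set functions and `w` weights with `Σ w_x = 1`.
If any two coordinates at which the family `(β^x)_x` is non-constant intersect (`β^x_S ≠ β^y_S`, `β^{x'}_T ≠ β^{y'}_T` force
`S ∩ T ≠ ∅`), then `Φ_n(Σ_x w_x β^x) = Σ_x w_x Φ_n(β^x)`. [this work] -/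
theorem phiSet_mixture_eq_sum_of_inter {α : Type*} [Fintype α] (w : α → ℝ) (hw1 : ∑ x, w x = 1)
    (b : α → Finset (Fin n) → ℝ)
    (hI : ∀ S T : Finset (Fin n), (∃ x y, b x S ≠ b y S) → (∃ x y, b x T ≠ b y T) → ¬ Disjoint S T) :
    phiSet n (fun S => ∑ x, w x * b x S) = ∑ x, w x * phiSet n (b x) := by
  -- the index type is nonempty since the weights sum to one
  have hne : Nonempty α := by
    by_contra hα
    rw [not_nonempty_iff] at hα
    rw [univ_eq_empty, sum_empty] at hw1
    exact zero_ne_one hw1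
  obtain ⟨x₀⟩ := hne
  -- supports: a difference `b x − b x₀` vanishes off the varying coordinates
  have hsupp : ∀ x S, b x S - b x₀ S ≠ 0 → ∃ x' y, b x' S ≠ b y S := fun x S h => ⟨x, x₀, sub_ne_zero.1 h⟩
  have hux : ∀ x, ∀ S T, Disjoint S T → (b x S - b x₀ S) * (b x T - b x₀ T) = 0 := by
    intro x S T hST
    by_contra h
    rcases mul_ne_zero_iff.1 h with ⟨hS, hT⟩
    exact hI S T (hsupp x S hS) (hsupp x T hT) hST
  set u : Finset (Fin n) → ℝ := fun S => ∑ x, w x * (b x S - b x₀ S) with hu_def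
  have hu : ∀ S T, Disjoint S T → u S * u T = 0 := by
    intro S T hST
    by_contra h
    rcases mul_ne_zero_iff.1 h with ⟨hS, hT⟩
    obtain ⟨x, _, hx⟩ := exists_ne_zero_of_sum_ne_zero hS
    obtain ⟨x', _, hx'⟩ := exists_ne_zero_of_sum_ne_zero hT
    have hS' : b x S - b x₀ S ≠ 0 := fun h0 => hx (by rw [h0, mul_zero])
    have hT' : b x' T - b x₀ T ≠ 0 := fun h0 => hx' (by rw [h0, mul_zero])
    exact hI S T (hsupp x S hS') (hsupp x' T hT') hST
  -- the mixture is `b x₀ + u`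
  have emix : (fun S => ∑ x, w x * b x S) = fun S => b x₀ S + u S := by
    funext S
    simp only [hu_def, mul_sub, sum_sub_distrib]
    rw [← sum_mul, hw1, one_mul]
    ring
  rw [emix, phiSet_add_of_inter (b x₀) u hu]
  -- each `b x = b x₀ + (b x − b x₀)`
  set L : α → ℝ := fun x => ∑ c : OrderedFinpartition n, (-1 : ℝ) ^ (c.length - 1) *
        ∑ j : Fin c.length, (((c.partSize j - 1).factorial : ℝ) *
            (b x (PartitionForm.block c j) - b x₀ (PartitionForm.block c j))) *
          ∏ i ∈ univ.erase j, (((c.partSize i - 1).factorial : ℝ) * b x₀ (PartitionForm.block c i)) with hL_def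
  have ex : ∀ x, phiSet n (b x) = phiSet n (b x₀) + L x := by
    intro x
    have e := phiSet_add_of_inter (b x₀) (fun S => b x S - b x₀ S) (hux x)
    have e' : (fun S => b x₀ S + (b x S - b x₀ S)) = b x := by funext S; ring
    rw [e'] at e
    rw [e]
  have hR : ∑ x, w x * phiSet n (b x) = phiSet n (b x₀) + ∑ x, w x * L x := by
    rw [show ∑ x, w x * phiSet n (b x) = ∑ x, (w x * phiSet n (b x₀) + w x * L x) from
      sum_congr rfl fun x _ => by rw [ex x, mul_add], sum_add_distrib, ← sum_mul, hw1, one_mul]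
  rw [hR]
  congr 1
  -- linearity of the explicit expression in `u`
  simp only [hL_def, hu_def, mul_sum, sum_mul]
  rw [sum_comm]
  refine sum_congr rfl fun c _ => ?_
  rw [sum_comm]
  refine sum_congr rfl fun j _ => ?_
  refine sum_congr rfl fun x _ => ?_
  ring

/-- **`(UC-hull)_n` on intersecting-variation mixtures, every `n ≥ 1`.**  Let `𝒰_x` (`x ∈ α`, finite) be union-closed families of
subsets of `Fin n` containing `univ`, and `w ≥ 0` weights with `Σ w_x = 1`.  If the sets on which the families DIFFER pairwise
intersect (`S ∈ 𝒰_x ∖ 𝒰_y`, `T ∈ 𝒰_{x'} ∖ 𝒰_{y'}` force `S ∩ T ≠ ∅`), then the mixture `β = Σ_x w_x 1_{𝒰_x}` has `Φ_n(β) ≥ 0` —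
indeed `Φ_n(β) = Σ_x w_x Φ_n(1_{𝒰_x})` and each vertex value is `≥ 0` by (V) (`PhiVertex`). [this work] -/
theorem ucHull_of_inter (hn : 1 ≤ n) {α : Type*} [Fintype α] (w : α → ℝ) (𝒰 : α → Finset (Finset (Fin n)))
    (hw0 : ∀ x, 0 ≤ w x) (hw1 : ∑ x, w x = 1) (hUC : ∀ x, ∀ A ∈ 𝒰 x, ∀ A' ∈ 𝒰 x, A ∪ A' ∈ 𝒰 x) (htop : ∀ x, univ ∈ 𝒰 x)
    (hI : ∀ S T : Finset (Fin n), (∃ x y, S ∈ 𝒰 x ∧ S ∉ 𝒰 y) → (∃ x y, T ∈ 𝒰 x ∧ T ∉ 𝒰 y) → ¬ Disjoint S T) :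
    0 ≤ phiSet n (fun S => ∑ x, w x * (if S ∈ 𝒰 x then (1 : ℝ) else 0)) := by
  have hI' : ∀ S T : Finset (Fin n),
      (∃ x y, (if S ∈ 𝒰 x then (1 : ℝ) else 0) ≠ (if S ∈ 𝒰 y then (1 : ℝ) else 0)) →
      (∃ x y, (if T ∈ 𝒰 x then (1 : ℝ) else 0) ≠ (if T ∈ 𝒰 y then (1 : ℝ) else 0)) → ¬ Disjoint S T := by
    intro S T hS hT
    refine hI S T ?_ ?_
    · obtain ⟨x, y, hxy⟩ := hS
      by_cases hx : S ∈ 𝒰 x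
      · by_cases hy : S ∈ 𝒰 y
        · rw [if_pos hx, if_pos hy] at hxy; exact absurd rfl hxy
        · exact ⟨x, y, hx, hy⟩
      · by_cases hy : S ∈ 𝒰 y
        · exact ⟨y, x, hy, hx⟩
        · rw [if_neg hx, if_neg hy] at hxy; exact absurd rfl hxy
    · obtain ⟨x, y, hxy⟩ := hT
      by_cases hx : T ∈ 𝒰 x
      · by_cases hy : T ∈ 𝒰 y
        · rw [if_pos hx, if_pos hy] at hxy; exact absurd rfl hxy
        · exact ⟨x, y, hx, hy⟩
      · by_cases hy : T ∈ 𝒰 y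
        · exact ⟨y, x, hy, hx⟩
        · rw [if_neg hx, if_neg hy] at hxy; exact absurd rfl hxy
  rw [phiSet_mixture_eq_sum_of_inter w hw1 (fun x S => if S ∈ 𝒰 x then (1 : ℝ) else 0) hI']
  exact sum_nonneg fun x _ => mul_nonneg (hw0 x) (PhiVertex.phiSet_indicator_nonneg_of_unionClosed hn (𝒰 x) (hUC x) (htop x))

/-- **Two families** (the edge `[1_𝒰, 1_𝒱]` of the union-closed polytope): if `𝒰, 𝒱 ∋ univ` are union-closed and the symmetric
difference `𝒰 Δ 𝒱` is a pairwise-intersecting family, then `Φ_n(w·1_𝒰 + (1−w)·1_𝒱) ≥ 0` for every `w ∈ [0,1]`, every `n ≥ 1`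
(`Φ` is affine on the edge). [this work] -/
theorem ucHull_pair_of_inter (hn : 1 ≤ n) (𝒰 𝒱 : Finset (Finset (Fin n)))
    (hU : ∀ A ∈ 𝒰, ∀ A' ∈ 𝒰, A ∪ A' ∈ 𝒰) (hV : ∀ A ∈ 𝒱, ∀ A' ∈ 𝒱, A ∪ A' ∈ 𝒱) (hUt : univ ∈ 𝒰) (hVt : univ ∈ 𝒱)
    (hI : ∀ S T : Finset (Fin n), (S ∈ 𝒰 ↔ S ∉ 𝒱) → (T ∈ 𝒰 ↔ T ∉ 𝒱) → ¬ Disjoint S T)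
    {w : ℝ} (hw0 : 0 ≤ w) (hw1 : w ≤ 1) :
    0 ≤ phiSet n (fun S => w * (if S ∈ 𝒰 then (1 : ℝ) else 0) + (1 - w) * (if S ∈ 𝒱 then (1 : ℝ) else 0)) := by
  have h := phiSet_lineMap_of_inter (fun S => if S ∈ 𝒱 then (1 : ℝ) else 0) (fun S => if S ∈ 𝒰 then (1 : ℝ) else 0)
    (fun S T hST => ?_) w
  · have e : (fun S => (1 - w) * (if S ∈ 𝒱 then (1 : ℝ) else 0) + w * (if S ∈ 𝒰 then (1 : ℝ) else 0)) =
        fun S => w * (if S ∈ 𝒰 then (1 : ℝ) else 0) + (1 - w) * (if S ∈ 𝒱 then (1 : ℝ) else 0) := by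
      funext S; ring
    rw [e] at h
    rw [h]
    exact add_nonneg (mul_nonneg (sub_nonneg.2 hw1) (PhiVertex.phiSet_indicator_nonneg_of_unionClosed hn 𝒱 hV hVt))
      (mul_nonneg hw0 (PhiVertex.phiSet_indicator_nonneg_of_unionClosed hn 𝒰 hU hUt))
  · -- the difference of the two indicators is supported on `𝒰 Δ 𝒱`
    by_contra hne
    rcases mul_ne_zero_iff.1 hne with ⟨hS, hT⟩
    have key : ∀ R : Finset (Fin n), (if R ∈ 𝒰 then (1 : ℝ) else 0) - (if R ∈ 𝒱 then (1 : ℝ) else 0) ≠ 0 → (R ∈ 𝒰 ↔ R ∉ 𝒱) := by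
      intro R hR
      by_cases hu : R ∈ 𝒰 <;> by_cases hv : R ∈ 𝒱 <;> simp [hu, hv] at hR ⊢
    exact hI S T (key S hS) (key T hT) hST

end PhiAffine

end Summit.CriticalPhenomena.PercolationContinuityZ3.Theorems
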